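import Summits.Langlands.Langlands.Theorems.PicardMuOrdinaryMuOrdinaryFamilyRTThornePointAutomorphicDebts
import Literature.NumberTheory.NumberFields.SolubleCMExtensionPrescribedLocal
import Literature.NumberTheory.PAdicHodge.CrystallineOfOrdinaryRegular
import Literature.NumberTheory.GaloisRepresentations.CyclotomicCharacterArtinNorm
import HarnessLib

/-!
# Line `thorne-minimal-lift`, the lead's stub `stub_pointAutomorphicTw`: ASSEMBLY through the three-way cut (workfile; lead c3, 2026-08-17)

`stub_pointAutomorphicTw_of : (Thorne fact for canonical Artin data) → (canonical Artin data exist) → PA-I → PA-C → PA-O → stub_pointAutomorphicTw`,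
kernel-checked, where PA-I `thorneInputOverL` is the GALOIS input over the soluble CM extension (glue: CHT 4.1.2 fact F1, Gee–Geraghty F7, ε∘Art = N F9, and the
landed G1, G2, G2b, G4, G4b, G5 + the remaining G6, G8, G10, G11 — the registered stub of this file), PA-C/PA-O the typed automorphic debts of
…ThornePointAutomorphicDebts.
-/

set_option linter.dupNamespace false

namespace Summit.Langlands.Langlands.Cruxes.MuOrdinaryFamilyRT.ThorneMinimalLift

open scoped NumberField Polynomial Matrix Classical
open Field IsDedekindDomain Polynomial Filter
open Literature.NumberTheory.GaloisRepresentations Literature.NumberTheory.Automorphic Literature.NumberTheory.PAdicHodge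
open Literature.NumberTheory.NumberFields
open Summit.Langlands.Langlands.Cruxes.MuOrdinaryFamilyRT.CharZeroDominance

noncomputable section

/-! ## 1. PA-I — the Galois input over the soluble CM extension (registered stub; glue) -/

/-- **PA-I `thorneInputOverL` — the GALOIS half of Thorne's hypotheses for the twisted point representation and the twisted companion, over a soluble CM
extension `L/F'`** (from the Literature facts F1 = CHT 4.1.2, F7 = Gee–Geraghty 3.1.4(3), F9 = `ε ∘ Art = N`, for canonical Artin data).  Given the data of
`stub_pointAutomorphicTw` with the companion `r^c` unpacked (clauses (c), (d), (e), (f)), there are a finite soluble Galois CM extension `L/F'`, a residual representation `τ`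
and a lift `c` of complex conjugation with `GaloisThorneData 𝓐 L ((ρ_y|F' ⊗ θ)|L) ((r^c ⊗ θ)|L) τ c`, both restrictions irreducible, and (over `F'`) the `ε^{-2}`-polarization
and the unramifiedness off `S' ∪ 3` of `ρ_y|F' ⊗ θ`.  Proof plan: blueprint § 6 PA-I. -/
theorem thorneInputOverL : ClozelHarrisTaylor2008.exists_solvable_cm_extension_local → GeeGeraghty2012.crystalline_of_ordinary_regular → cyclotomicCharacter_artin_eq_norm → ∀ (𝓐 : ∀ (K : Type) [Field K] [NumberField K] (v : HeightOneSpectrum (𝓞 K)), LocalArtinData (v.adicCompletion K)), (∀ (K : Type) [Field K] [NumberField K] (v : HeightOneSpectrum (𝓞 K)), (𝓐 K v).IsCanonical) → ∀ (f : ℤ[X]) (ι : PadicAlgCl 3 ≃+* ℂ) (e : K →+* ℂ) (S₀ : Finset (HeightOneSpectrum (𝓞 K))) (ρC : FramedGaloisRep K (PadicAlgCl 3) 3) (𝓕 : OrdFamily f ι e S₀ ρC), Generic f → PicardInput f ι e S₀ ρC → MainClassPlus f S₀ ρC → PotUnramifiedFamily 𝓕 → ∀ (F' : Type) [Field F'] [NumberField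 F'] [Algebra K F'] [IsGalois ℚ F'] [NumberField.IsCMField F'] (S' : Finset (HeightOneSpectrum (𝓞 F'))), Module.finrank K F' = 2 → ThreeSplitFromMaximalReal F' → ((rbar f 𝓕.B).comp (absGaloisRestrict K F').toMonoidHom).range = (rbar f 𝓕.B).range → (∀ w : HeightOneSpectrum (𝓞 F'), w.under (𝓞 K) ∈ S₀ → w ∈ S') → ∀ θ : absoluteGaloisGroup F' →ₜ* (PadicAlgCl 3)ˣ, TwistData 𝓕.m F' S' θ → ∀ (y : 𝓕.R →+* PadicAlgCl 3) (ρy : FramedGaloisRep K (PadicAlgCl 3) 3), (∀ g, ρy g = pointRep 𝓕 y g) → FramedRep.IsAbsolutelyIrreducible (ρy.restrictField F') → ∀ rc : FramedGaloisRep F' (PadicAlgCl 3) 3, (∀ w ∈ S', ((3 : ℕ) : 𝓞 F') ∉ w.asIdeal → ∃ U : OpenSubgroup (absoluteGaloisGroup (w.adicCompletion F')), ∀ τ ∈ absInertia (w.adicCompletion F'), τ ∈ U → rc (absGaloisRestrict F' (w.adicCompletion F') τ) = 1) → (∀ N : ℕ, ∃ M : ℕ, ∀ r ∈ IsLocalRing.maximalIdeal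 𝓕.R ^ M, ‖y r‖ ≤ ((3 : ℝ)⁻¹) ^ N) → (∀ r : 𝓕.R, ‖y r‖ ≤ 1) → (∃ g : GL (Fin 3) (PadicAlgCl 3), ∀ (σ : absoluteGaloisGroup F') (i j : Fin 3), ‖(g⁻¹ * rc σ * g).val i j‖ ≤ 1 ∧ ‖(g⁻¹ * rc σ * g).val i j - (pointRep 𝓕 y (absGaloisRestrict K F' σ)).val i j‖ < 1) → (∀ w : HeightOneSpectrum (𝓞 F'), ((3 : ℕ) : 𝓞 F') ∈ w.asIdeal → ∀ art : LocalArtinData (w.adicCompletion F'), art.IsCanonical → ∃ wt : LabelledWeight (w.adicCompletion F') (PadicAlgCl 3) 3, (∀ τ (i j : Fin 3), i < j → wt τ j + 2 ≤ wt τ i) ∧ rc.IsOrdinaryOfLabelledWeightAt w art wt ∧ ∃ (g : GL (Fin 3) (PadicAlgCl 3)) (U : OpenSubgroup (absoluteGaloisGroup (w.adicCompletion F'))), (∀ τ : absoluteGaloisGroup (w.adicCompletion F'), IsUpper3 (g⁻¹ * pointRep 𝓕 y (absGaloisRestrict K F' (absGaloisRestrict F' (w.adicCompletion F') τ)) * g).val)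 ∧ ∀ τw ∈ WeilGroup.inertia (w.adicCompletion F'), WeilGroup.toAbsGalois (w.adicCompletion F') τw ∈ U → ∀ i : Fin 3, (g⁻¹ * pointRep 𝓕 y (absGaloisRestrict K F' (absGaloisRestrict F' (w.adicCompletion F') (WeilGroup.toAbsGalois (w.adicCompletion F') τw))) * g).val i i = (ordinaryWeightUnit wt i (art.artin τw) : PadicAlgCl 3)) → UnramifiedOff F' S' rc → ∃ (L : Type) (_ : Field L) (_ : NumberField L) (_ : NumberField.IsCMField L) (_ : Algebra F' L) (_ : IsGalois F' L) (_ : IsSolvable (L ≃ₐ[F'] L)) (τ : absoluteGaloisGroup L →* GL (Fin 3) (padicAlgClResidueField 3)) (c : absoluteGaloisGroup (NumberField.maximalRealSubfield L)), GaloisThorneData 𝓐 L (FramedGaloisRep.restrictField L ((ρy.restrictField F').twist θ)) (FramedGaloisRep.restrictField L (rc.twist θ)) τ c ∧ (FramedGaloisRep.restrictField L ((ρy.restrictField F').twist θ)).toGaloisRep.IsIrreducible ∧ (FramedGaloisRep.restrictField L (rc.twist θ)).toGaloisRep.IsIrreducible ∧ TracePolarized F' (-2) ((ρy.restrictField F').twist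 θ) ∧ (∀ w : HeightOneSpectrum (𝓞 F'), w ∉ S' → ((3 : ℕ) : 𝓞 F') ∉ w.asIdeal → FramedGaloisRep.IsUnramifiedAt w ((ρy.restrictField F').twist θ)) := by
  sorry

/-! ## 2. The assembly -/

/-- **`stub_pointAutomorphicTw` from the Thorne fact, canonical Artin data, the three Literature facts of PA-I, PA-I itself (above) and the two automorphic
debts PA-C, PA-O** (kernel-checked: unpack the Thorne-ready companion; PA-I gives `L`, `τ`, `c` and the Galois half of Thorne's hypotheses for
`ρ' = (ρ_y|F' ⊗ θ)|L` with companion `(r^c ⊗ θ)|L`; PA-C gives the automorphic half; `thorne_apply` gives `IsAutomorphic ι ρ'`; PA-O descends, untwists and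
packages the classicality clauses over `F'`). -/
theorem stub_pointAutomorphicTw_of
    (hT : ∀ 𝓐 : ∀ (K : Type) [Field K] [NumberField K] (v : HeightOneSpectrum (𝓞 K)), LocalArtinData (v.adicCompletion K),
      (∀ (K : Type) [Field K] [NumberField K] (v : HeightOneSpectrum (𝓞 K)), (𝓐 K v).IsCanonical) →
      Thorne2017.automorphyLifting_unitary_ordinaryMinimal 𝓐)
    (h𝓐 : ∃ 𝓐 : ∀ (K : Type) [Field K] [NumberField K] (v : HeightOneSpectrum (𝓞 K)), LocalArtinData (v.adicCompletion K),
      ∀ (K : Type) [Field K] [NumberField K] (v : HeightOneSpectrum (𝓞 K)), (𝓐 K v).IsCanonical)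
    (hF1 : ClozelHarrisTaylor2008.exists_solvable_cm_extension_local)
    (hF7 : GeeGeraghty2012.crystalline_of_ordinary_regular) (hF9 : cyclotomicCharacter_artin_eq_norm)
    (hC : Missing.thorneCompanionOverL) (hO : Missing.classicalOfAutomorphicTwist) :
    ∀ (f : ℤ[X]) (ι : PadicAlgCl 3 ≃+* ℂ) (e : K →+* ℂ) (S₀ : Finset (HeightOneSpectrum (𝓞 K)))
      (ρC : FramedGaloisRep K (PadicAlgCl 3) 3) (𝓕 : OrdFamily f ι e S₀ ρC),
      Generic f → PicardInput f ι e S₀ ρC → MainClassPlus f S₀ ρC → PotUnramifiedFamily 𝓕 →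
    ∀ (F' : Type) [Field F'] [NumberField F'] [Algebra K F'] [IsGalois ℚ F'] [NumberField.IsCMField F']
      (hcpt' : isCompact_glFiniteIntegralLevel 3 F') (S' : Finset (HeightOneSpectrum (𝓞 F'))),
      Module.finrank K F' = 2 → ThreeSplitFromMaximalReal F' →
      ((rbar f 𝓕.B).comp (absGaloisRestrict K F').toMonoidHom).range = (rbar f 𝓕.B).range →
      (∀ w : HeightOneSpectrum (𝓞 F'), w.under (𝓞 K) ∈ S₀ → w ∈ S') →
    ∀ θ : absoluteGaloisGroup F' →ₜ* (PadicAlgCl 3)ˣ, TwistData 𝓕.m F' S' θ →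
    ∀ (y : 𝓕.R →+* PadicAlgCl 3) (ρy : FramedGaloisRep K (PadicAlgCl 3) 3),
      (∀ g, ρy g = pointRep 𝓕 y g) → FramedRep.IsAbsolutelyIrreducible (ρy.restrictField F') →
      HasThorneCompanion 𝓕 F' hcpt' S' y →
      ∃ P' : CuspidalAutomorphicRepData 3 F' hcpt',
        P'.1.IsRegularAlgebraic ∧
        ∀ w ∉ S', (∃ α : Multiset ℂ, P'.1.HasSatakeParamAt w α ∧
            ∀ a ∈ α, IsIntegral ℤ ((w.residueCard : ℂ) * a)) ∧
          (((3 : ℕ) : 𝓞 F') ∉ w.asIdeal → IsGaloisCompatibleAt P'.1 ι (ρy.restrictField F') w) := by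
  intro f ι e S₀ ρC 𝓕 hgen hin hM hpur F' _ _ _ _ _ hcpt' S' hdeg hsplit hrange hS' θ hθ y ρy hρy hirr hy
  obtain ⟨Pc, rc, -, -, hb, hc, hd₁, hd₂, hd₃, he, hf, haut⟩ := hy
  obtain ⟨𝓐, h𝓐c⟩ := h𝓐
  obtain ⟨L, iF, iN, iCM, iA, iG, hsol, τ, c, hG, hirrρ, hirrr, hpol, hunr⟩ :=
    thorneInputOverL hF1 hF7 hF9 𝓐 h𝓐c f ι e S₀ ρC 𝓕 hgen hin hM hpur F' S' hdeg hsplit hrange hS' θ hθ y ρy hρy hirr rc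
      hc hd₁ hd₂ hd₃ he hf
  have hcptL : isCompact_glFiniteIntegralLevel 3 L := isCompact_glFiniteIntegralLevel_holds 3 L
  obtain ⟨πL, hA⟩ := hC F' ι S' 𝓕.m θ hθ rc haut hb L hsol hirrr hcptL
  have hautρ : Qian2022.IsAutomorphic ι (FramedGaloisRep.restrictField L ((ρy.restrictField F').twist θ)) :=
    thorne_apply (hT 𝓐 h𝓐c) hcptL ι πL hG hA
  exact hO F' ι hcpt' S' 𝓕.m θ hθ (ρy.restrictField F') hpol hunr L hsol hirrρ hautρ

end

end Summit.Langlands.Langlands.Cruxes.MuOrdinaryFamilyRT.ThorneMinimalLift
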